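import Literature.Probability.RandomPlanarGeometry.BrownianExitPathLaw
import Literature.Probability.Process.MaximalIneqNonneg
import Literature.Probability.Process.BrownianIncrementSup
import Mathlib.Probability.Moments.Basic
import Mathlib.Topology.Maps.Proper.Basic
import HarnessLib

/-!
# Gaussian tails of the running maximum and of the oscillation of Brownian motion

Topic `Literature/Probability/RandomPlanarGeometry` (next to `BrownianStrongMarkov`,
`BrownianExitPathLaw`); theorems only, no definition and no named fact.

This is brick B3c of Part B of the printed proof of `LSW2001_srw_nonIntersection_five_eighths`
(Lawler, *Cut times for simple random walk*, EJP **1** (1996), paper 13, §3, third display: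
"Similar exponential estimates for the Brownian motion give
`P{sup_{0≤t≤n} sup_{0≤s≤n^{1/2+ε}} |X(t) - X(t+s)| ≥ n^{1/4+ε}} ≤ a e^{-n^δ}`"). We prove the
underlying estimates for the canonical Brownian motion `B = Process.brownian` on the pre-Wiener
space and transfer the oscillation bound to the Wiener law `wienerLawC` on `C([0, ∞), ℝ)`:

* `martingale_exp_brownian` — **the exponential martingale** `exp(λB_t - λ²t/2)` (raw natural
  filtration; independence of increments + Gaussian m.g.f.);
* `measure_exists_le_abs_brownian_le_exp` — **Gaussian tail of the running maximum**,
  `P[∃ s ≤ h, x ≤ |B_s|] ≤ 2 exp(-x²/(2h))` (Doob's maximal inequality for the nonnegative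
  exponential martingale, `measure_exists_le_of_martingale_nonneg`, at `λ = ±x/h`);
* `measure_le_incRunSup_le_exp` — the same for the increments after a fixed time `u`
  (stationarity, `identDistrib_brownian_shift`);
* `measure_osc_le_exp` — **oscillation bound**: `P[∃ u ≤ T, ∃ v ∈ [u, u+h], x ≤ |B_v - B_u|]
  ≤ (T/h + 1) · 2 exp(-x²/(16h))` (blocks of length `h`);
* `isClosed_oscSet`, `wienerLawC_osc_le_exp` — the oscillation event is closed in `C([0,∞), ℝ)`
  and the same bound holds under the Wiener law.

## References

* G. F. Lawler, *Cut times for simple random walk*, Electron. J. Probab. **1** (1996), no. 13,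
  §3. [Lawler1996CutTimes]
* D. Revuz, M. Yor, *Continuous Martingales and Brownian Motion* (1999), Ch. II, Thm (1.7) and
  Prop. (1.8) (exponential martingale and `P[sup_{s≤t} B_s ≥ x] ≤ exp(-x²/2t)`). [RevuzYor1999]
-/

noncomputable section

open MeasureTheory ProbabilityTheory Filter Set Real
open scoped NNReal ENNReal Topology

namespace Literature.Probability.RandomPlanarGeometry

open Literature.Probability.Process

/-! ### The exponential martingale of the canonical Brownian motion -/

/-- **Gaussian m.g.f. of the increments**: `E exp(λ(B_t - B_s)) = exp(λ²(t-s)/2)` for `s ≤ t`.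
[folklore] -/
theorem integral_exp_mul_brownian_sub {s t : ℝ≥0} (hst : s ≤ t) (l : ℝ) :
    ∫ ω, exp (l * (Process.brownian t ω - Process.brownian s ω)) ∂Process.preWienerMeasure =
      exp (l ^ 2 * ((t : ℝ) - s) / 2) := by
  have hlaw := isPreBrownianReal_brownian.hasLaw_sub t s
  have h := mgf_gaussianReal hlaw.map_eq l
  simp only [mgf, Pi.sub_apply, zero_mul, zero_add] at h
  rw [h]
  congr 1
  rw [coe_nndist, Real.dist_eq, abs_of_nonneg]
  · simp only [NNReal.val_eq_coe]
    ring
  · have := NNReal.coe_le_coe.2 hst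
    exact sub_nonneg.2 this

/-- The exponentials of the increments are integrable. [folklore] -/
theorem integrable_exp_mul_brownian_sub (s t : ℝ≥0) (l : ℝ) :
    Integrable (fun ω ↦ exp (l * (Process.brownian t ω - Process.brownian s ω)))
      Process.preWienerMeasure := by
  have hlaw := isPreBrownianReal_brownian.hasLaw_sub t s
  have h : Integrable (fun x ↦ exp (l * x)) (Process.preWienerMeasure.map
      (Process.brownian t - Process.brownian s)) := by
    rw [hlaw.map_eq]
    exact integrable_exp_mul_gaussianReal l
  exact (integrable_map_measure (measurable_id.const_mul l).exp.aestronglyMeasurable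
    hlaw.aemeasurable).1 h

/-- The exponential `exp(λ B_t)` is integrable. [folklore] -/
theorem integrable_exp_mul_brownian (t : ℝ≥0) (l : ℝ) :
    Integrable (fun ω ↦ exp (l * Process.brownian t ω)) Process.preWienerMeasure := by
  have h := integrable_exp_mul_brownian_sub 0 t l
  simp only [Process.brownian_zero, Pi.zero_apply, sub_zero] at h
  exact h

/-- **Conditional m.g.f. of the increments**: `E[exp(λ(B_t - B_s)) | 𝓕ᵂ_s] = exp(λ²(t-s)/2)` a.s.
(independence of the increment from `𝓕ᵂ_s`). Revuz–Yor (1999), Ch. II, Prop. (1.2).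
[folklore] -/
theorem condExp_exp_mul_brownian_sub {s t : ℝ≥0} (hst : s ≤ t) (l : ℝ) :
    Process.preWienerMeasure[fun ω ↦ exp (l * (Process.brownian t - Process.brownian s) ω) |
      brownianFiltration s] =ᵐ[Process.preWienerMeasure] fun _ ↦ exp (l ^ 2 * ((t : ℝ) - s) / 2) := by
  haveI := isProbabilityMeasure_preWienerMeasure'
  have hmeas : Measurable (Process.brownian t - Process.brownian s) :=
    (Process.measurable_brownian t).sub (Process.measurable_brownian s)
  have hexp : Measurable[MeasurableSpace.comap (Process.brownian t - Process.brownian s) inferInstance]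
      (fun ω ↦ exp (l * (Process.brownian t - Process.brownian s) ω)) :=
    ((measurable_iff_comap_le.2 le_rfl).const_mul l).exp
  have h := condExp_indep_eq
    (m₁ := MeasurableSpace.comap (Process.brownian t - Process.brownian s) inferInstance)
    (μ := Process.preWienerMeasure) (f := fun ω ↦ exp (l * (Process.brownian t - Process.brownian s) ω))
    (measurable_iff_comap_le.1 hmeas) (brownianFiltration.le s) hexp.stronglyMeasurable
    (indep_comap_brownian_sub_brownianFiltration hst)
  refine h.trans (Eventually.of_forall fun ω ↦ ?_)
  exact integral_exp_mul_brownian_sub hst l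

/-- The exponential martingale is strongly adapted. [folklore] -/
theorem stronglyAdapted_exp_brownian (l : ℝ) :
    StronglyAdapted brownianFiltration fun t ω ↦ exp (l * Process.brownian t ω - l ^ 2 * t / 2) :=
  fun t ↦ continuous_exp.comp_stronglyMeasurable
    (((stronglyAdapted_brownian t).const_mul l).sub stronglyMeasurable_const)

/-- **The exponential martingale of Brownian motion**: `t ↦ exp(λB_t - λ²t/2)` is a martingale for
the raw natural filtration under the pre-Wiener measure. Revuz–Yor (1999), Ch. II, Prop. (1.2)
(iii). [cite: RevuzYor1999, Ch. II Prop. (1.2)] -/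
theorem martingale_exp_brownian (l : ℝ) :
    Martingale (fun t ω ↦ exp (l * Process.brownian t ω - l ^ 2 * t / 2)) brownianFiltration
      Process.preWienerMeasure := by
  haveI := isProbabilityMeasure_preWienerMeasure'
  refine ⟨stronglyAdapted_exp_brownian l, fun s t hst ↦ ?_⟩
  -- `M_t = M_s · (c • f)`, `f = exp(λ(B_t - B_s))`, `c = exp(-λ²(t - s)/2)`
  set Ms : (ℝ≥0 → ℝ) → ℝ := fun ω ↦ exp (l * Process.brownian s ω - l ^ 2 * s / 2) with hMs
  set f : (ℝ≥0 → ℝ) → ℝ := fun ω ↦ exp (l * (Process.brownian t - Process.brownian s) ω) with hf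
  set c : ℝ := exp (-(l ^ 2 * ((t : ℝ) - s) / 2)) with hc
  have hdec : (fun ω ↦ exp (l * Process.brownian t ω - l ^ 2 * t / 2)) = Ms * (c • f) := by
    funext ω
    simp only [hMs, hf, hc, Pi.mul_apply, Pi.smul_apply, smul_eq_mul, Pi.sub_apply, ← Real.exp_add]
    congr 1
    ring
  have hfint : Integrable f Process.preWienerMeasure := integrable_exp_mul_brownian_sub s t l
  have hGint : Integrable (c • f) Process.preWienerMeasure := hfint.smul c
  have hMt : Integrable (fun ω ↦ exp (l * Process.brownian t ω - l ^ 2 * t / 2))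
      Process.preWienerMeasure := by
    have := (integrable_exp_mul_brownian t l).mul_const (exp (-(l ^ 2 * (t : ℝ) / 2)))
    refine this.congr (ae_of_all _ fun ω ↦ ?_)
    change exp (l * Process.brownian t ω) * exp (-(l ^ 2 * (t : ℝ) / 2)) =
      exp (l * Process.brownian t ω - l ^ 2 * t / 2)
    rw [← Real.exp_add]
    ring_nf
  have hMsG : Integrable (Ms * (c • f)) Process.preWienerMeasure := hdec ▸ hMt
  have hpull := condExp_mul_of_stronglyMeasurable_left (stronglyAdapted_exp_brownian l s) hMsG hGint
    (m := brownianFiltration s) (μ := Process.preWienerMeasure)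
  have hGcond : Process.preWienerMeasure[c • f | brownianFiltration s] =ᵐ[Process.preWienerMeasure]
      fun _ ↦ (1 : ℝ) := by
    have h1 := condExp_exp_mul_brownian_sub hst l
    have h2 := condExp_smul (μ := Process.preWienerMeasure) (m := brownianFiltration s) c f
    filter_upwards [h1, h2] with ω hω hω'
    rw [hω', Pi.smul_apply, smul_eq_mul, hω, hc, ← Real.exp_add]
    convert Real.exp_zero using 2
    ring
  change Process.preWienerMeasure[fun ω ↦ exp (l * Process.brownian t ω - l ^ 2 * t / 2) |
    brownianFiltration s] =ᵐ[Process.preWienerMeasure] Ms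
  rw [hdec]
  filter_upwards [hpull, hGcond] with ω hω hω'
  rw [hω, Pi.mul_apply, hω', mul_one]

/-- **The exponential martingale has mean one**: `E exp(λB_t - λ²t/2) = 1`. [folklore] -/
theorem integral_exp_brownian (l : ℝ) (t : ℝ≥0) :
    ∫ ω, exp (l * Process.brownian t ω - l ^ 2 * t / 2) ∂Process.preWienerMeasure = 1 := by
  have h := integral_exp_mul_brownian_sub (s := 0) (t := t) bot_le l
  simp only [Process.brownian_zero, Pi.zero_apply, sub_zero, NNReal.coe_zero] at h
  have : (fun ω ↦ exp (l * Process.brownian t ω - l ^ 2 * t / 2)) =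
      fun ω ↦ exp (l * Process.brownian t ω) * exp (-(l ^ 2 * t / 2)) := by
    funext ω
    rw [← Real.exp_add]
    ring_nf
  rw [this, integral_mul_const, h, ← Real.exp_add]
  convert Real.exp_zero using 2
  ring

/-! ### Gaussian tail of the running maximum -/

/-- **Doob's inequality for the exponential martingale**: `P[∃ s ≤ h, e^c ≤ exp(λB_s - λ²s/2)] ≤ e^{-c}`.
Revuz–Yor (1999), Ch. II, Thm (1.7). [folklore] -/
theorem measure_exists_le_exp_brownian_le (l c : ℝ) (h : ℝ≥0) :
    Process.preWienerMeasure {ω | ∃ s ≤ h, exp c ≤ exp (l * Process.brownian s ω - l ^ 2 * s / 2)} ≤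
      ENNReal.ofReal (exp (-c)) := by
  haveI := isProbabilityMeasure_preWienerMeasure'
  have hM := martingale_exp_brownian l
  have hnn : 0 ≤ fun t ω ↦ exp (l * Process.brownian t ω - l ^ 2 * t / 2) :=
    fun t ω ↦ (exp_nonneg _)
  have hcont : ∀ᵐ ω ∂Process.preWienerMeasure,
      Continuous (fun t : ℝ≥0 ↦ exp (l * Process.brownian t ω - l ^ 2 * t / 2)) :=
    ae_of_all _ fun ω ↦ continuous_exp.comp
      (((Process.continuous_brownian ω).const_mul l).sub
        ((continuous_const.mul NNReal.continuous_coe).div_const _))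
  have hD := measure_exists_le_of_martingale_nonneg hM hnn hcont (exp_pos c) h
  rw [integral_exp_brownian l h] at hD
  refine hD.trans_eq ?_
  rw [one_div, Real.exp_neg]

/-- **Gaussian tail of the running maximum, upper**: `P[∃ s ≤ h, x ≤ B_s] ≤ exp(-x²/(2h))` for
`x > 0`. Revuz–Yor (1999), Ch. II, Prop. (1.8). [cite: RevuzYor1999, Ch. II Prop. (1.8)] -/
theorem measure_exists_le_brownian_le_exp (h : ℝ≥0) {x : ℝ} (hx : 0 < x) :
    Process.preWienerMeasure {ω | ∃ s ≤ h, x ≤ Process.brownian s ω} ≤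
      ENNReal.ofReal (exp (-x ^ 2 / (2 * h))) := by
  rcases eq_or_ne h 0 with rfl | h0
  · have : {ω : ℝ≥0 → ℝ | ∃ s ≤ (0 : ℝ≥0), x ≤ Process.brownian s ω} = ∅ := by
      ext ω
      simp only [mem_setOf_eq, mem_empty_iff_false, iff_false, not_exists, not_and, not_le]
      intro s hs
      rw [le_antisymm hs bot_le, Process.brownian_zero]
      exact hx
    rw [this, measure_empty]
    exact bot_le
  have hh : (0 : ℝ) < h := lt_of_le_of_ne h.coe_nonneg (fun h' ↦ h0 (by exact_mod_cast h'.symm))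
  set l := x / h with hl
  have hl0 : 0 < l := by positivity
  set c := x ^ 2 / (2 * h) with hc
  have hsub : {ω : ℝ≥0 → ℝ | ∃ s ≤ h, x ≤ Process.brownian s ω} ⊆
      {ω | ∃ s ≤ h, exp c ≤ exp (l * Process.brownian s ω - l ^ 2 * s / 2)} := by
    rintro ω ⟨s, hs, hxs⟩
    refine ⟨s, hs, Real.exp_le_exp.2 ?_⟩
    have hs' : (s : ℝ) ≤ h := by exact_mod_cast hs
    have h1 : l * x ≤ l * Process.brownian s ω := mul_le_mul_of_nonneg_left hxs hl0.le
    have h2 : l ^ 2 * (s : ℝ) / 2 ≤ l ^ 2 * h / 2 := by gcongr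
    have h3 : l * x - l ^ 2 * h / 2 = c := by
      rw [hl, hc]
      field_simp
      ring
    linarith
  refine (measure_mono hsub).trans ((measure_exists_le_exp_brownian_le l c h).trans_eq ?_)
  rw [hc, neg_div]

/-- **Gaussian tail of the running minimum**: `P[∃ s ≤ h, B_s ≤ -x] ≤ exp(-x²/(2h))` for `x > 0`.
[cite: RevuzYor1999, Ch. II Prop. (1.8)] -/
theorem measure_exists_brownian_le_neg_le_exp (h : ℝ≥0) {x : ℝ} (hx : 0 < x) :
    Process.preWienerMeasure {ω | ∃ s ≤ h, Process.brownian s ω ≤ -x} ≤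
      ENNReal.ofReal (exp (-x ^ 2 / (2 * h))) := by
  rcases eq_or_ne h 0 with rfl | h0
  · have : {ω : ℝ≥0 → ℝ | ∃ s ≤ (0 : ℝ≥0), Process.brownian s ω ≤ -x} = ∅ := by
      ext ω
      simp only [mem_setOf_eq, mem_empty_iff_false, iff_false, not_exists, not_and, not_le]
      intro s hs
      rw [le_antisymm hs bot_le, Process.brownian_zero]
      simp only [Pi.zero_apply]
      linarith
    rw [this, measure_empty]
    exact bot_le
  have hh : (0 : ℝ) < h := lt_of_le_of_ne h.coe_nonneg (fun h' ↦ h0 (by exact_mod_cast h'.symm))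
  set l := -(x / h) with hl
  have hl0 : 0 < x / h := by positivity
  set c := x ^ 2 / (2 * h) with hc
  have hsub : {ω : ℝ≥0 → ℝ | ∃ s ≤ h, Process.brownian s ω ≤ -x} ⊆
      {ω | ∃ s ≤ h, exp c ≤ exp (l * Process.brownian s ω - l ^ 2 * s / 2)} := by
    rintro ω ⟨s, hs, hxs⟩
    refine ⟨s, hs, Real.exp_le_exp.2 ?_⟩
    have hs' : (s : ℝ) ≤ h := by exact_mod_cast hs
    have h1 : x / h * x ≤ x / h * (-Process.brownian s ω) :=
      mul_le_mul_of_nonneg_left (by linarith) hl0.le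
    have h2 : (x / h) ^ 2 * (s : ℝ) / 2 ≤ (x / h) ^ 2 * h / 2 := by gcongr
    have h3 : x / h * x - (x / h) ^ 2 * h / 2 = c := by
      rw [hc]
      field_simp
      ring
    have h4 : l * Process.brownian s ω = x / h * (-Process.brownian s ω) := by rw [hl]; ring
    have h5 : l ^ 2 = (x / h) ^ 2 := by rw [hl]; ring
    rw [h4, h5]
    linarith
  refine (measure_mono hsub).trans ((measure_exists_le_exp_brownian_le l c h).trans_eq ?_)
  rw [hc, neg_div]

/-- **Two-sided Gaussian tail of the running maximum**: `P[∃ s ≤ h, x ≤ |B_s|] ≤ 2 exp(-x²/(2h))`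
for `x > 0`. Revuz–Yor (1999), Ch. II, Prop. (1.8). [cite: RevuzYor1999, Ch. II Prop. (1.8)] -/
theorem measure_exists_le_abs_brownian_le_exp (h : ℝ≥0) {x : ℝ} (hx : 0 < x) :
    Process.preWienerMeasure {ω | ∃ s ≤ h, x ≤ |Process.brownian s ω|} ≤
      ENNReal.ofReal (2 * exp (-x ^ 2 / (2 * h))) := by
  have hsub : {ω : ℝ≥0 → ℝ | ∃ s ≤ h, x ≤ |Process.brownian s ω|} ⊆
      {ω | ∃ s ≤ h, x ≤ Process.brownian s ω} ∪ {ω | ∃ s ≤ h, Process.brownian s ω ≤ -x} := by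
    rintro ω ⟨s, hs, hxs⟩
    rcases le_abs'.1 hxs with h' | h'
    · exact Or.inr ⟨s, hs, h'⟩
    · exact Or.inl ⟨s, hs, h'⟩
  calc Process.preWienerMeasure {ω | ∃ s ≤ h, x ≤ |Process.brownian s ω|}
      ≤ Process.preWienerMeasure {ω | ∃ s ≤ h, x ≤ Process.brownian s ω} +
          Process.preWienerMeasure {ω | ∃ s ≤ h, Process.brownian s ω ≤ -x} :=
        (measure_mono hsub).trans (measure_union_le _ _)
    _ ≤ ENNReal.ofReal (exp (-x ^ 2 / (2 * h))) + ENNReal.ofReal (exp (-x ^ 2 / (2 * h))) :=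
        add_le_add (measure_exists_le_brownian_le_exp h hx) (measure_exists_brownian_le_neg_le_exp h hx)
    _ = ENNReal.ofReal (2 * exp (-x ^ 2 / (2 * h))) := by
        rw [← ENNReal.ofReal_add (exp_nonneg _) (exp_nonneg _)]
        congr 1
        ring

/-! ### The running supremum of the increments after a fixed time -/

/-- **The running supremum is attained**: for every path there is `s ≤ h` with
`runSup h ω ≤ |B_s ω|` (continuous function on the compact interval `[0, h]`). [folklore] -/
theorem exists_runSup_le_abs_brownian (h : ℝ≥0) (ω : ℝ≥0 → ℝ) :
    ∃ s ≤ h, runSup h ω ≤ |Process.brownian s ω| := by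
  obtain ⟨s, hs, hmax⟩ := (isCompact_Icc (a := (0 : ℝ≥0)) (b := h)).exists_isMaxOn
    (nonempty_Icc.2 bot_le) ((Process.continuous_brownian ω).abs.continuousOn)
  refine ⟨s, hs.2, ciSup_le fun p ↦ ?_⟩
  exact hmax ⟨bot_le, dyadTime_le h p.1 p.2⟩

/-- **Gaussian tail of the running supremum**: `P[x ≤ runSup h] ≤ 2 exp(-x²/(2h))` for `x > 0`.
[cite: RevuzYor1999, Ch. II Prop. (1.8)] -/
theorem measure_le_runSup_le_exp (h : ℝ≥0) {x : ℝ} (hx : 0 < x) :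
    Process.preWienerMeasure {ω | x ≤ runSup h ω} ≤ ENNReal.ofReal (2 * exp (-x ^ 2 / (2 * h))) := by
  refine (measure_mono fun ω hω ↦ ?_).trans (measure_exists_le_abs_brownian_le_exp h hx)
  obtain ⟨s, hs, hle⟩ := exists_runSup_le_abs_brownian h ω
  exact ⟨s, hs, le_trans hω hle⟩

/-- The grid supremum functional on raw paths. [folklore] -/
theorem measurable_iSup_abs_apply_dyad (h : ℝ≥0) :
    Measurable fun f : ℝ≥0 → ℝ ↦ ⨆ p : ℕ × ℕ, |f (dyadTime h p.1 p.2)| :=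
  Measurable.iSup fun _ ↦ (measurable_pi_apply _).abs

/-- **Stationarity of the running supremum of the increments**: `incRunSup u h` has the law of
`runSup h` (weak Markov property at the fixed time `u`). [cite: Legall2016, Prop. 2.5 (ii)] -/
theorem identDistrib_incRunSup_runSup (u h : ℝ≥0) :
    IdentDistrib (incRunSup u h) (runSup h) Process.preWienerMeasure Process.preWienerMeasure := by
  have hid := (identDistrib_brownian_shift u).comp (measurable_iSup_abs_apply_dyad h)
  exact hid

/-- **Gaussian tail of the running supremum of the increments**:
`P[x ≤ sup_{v ≤ h} |B_{u+v} - B_u|] ≤ 2 exp(-x²/(2h))` for `x > 0`.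
[cite: RevuzYor1999, Ch. II Prop. (1.8)] -/
theorem measure_le_incRunSup_le_exp (u h : ℝ≥0) {x : ℝ} (hx : 0 < x) :
    Process.preWienerMeasure {ω | x ≤ incRunSup u h ω} ≤ ENNReal.ofReal (2 * exp (-x ^ 2 / (2 * h))) := by
  have hm := (identDistrib_incRunSup_runSup u h).measure_mem_eq (measurableSet_Ici (a := x))
  change Process.preWienerMeasure (incRunSup u h ⁻¹' Ici x) ≤ _
  rw [hm]
  exact measure_le_runSup_le_exp h hx

/-! ### The oscillation bound -/

/-- **Block reduction**: if `u ≤ v ≤ u + h` and `x ≤ |B_v - B_u|`, then for the block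
`j = ⌊u/h⌋` one has `x/2 ≤ sup_{w ≤ 2h} |B_{jh+w} - B_{jh}|`. [folklore] -/
theorem half_le_incRunSup_of_osc {h : ℝ≥0} (hh : 0 < h) {u v : ℝ≥0} (huv : u ≤ v) (hvu : v ≤ u + h)
    {x : ℝ} (ω : ℝ≥0 → ℝ) (hx : x ≤ |Process.brownian v ω - Process.brownian u ω|) :
    x / 2 ≤ incRunSup ((⌊u / h⌋₊ : ℝ≥0) * h) (2 * h) ω := by
  set j := ⌊u / h⌋₊ with hj
  set r : ℝ≥0 := (j : ℝ≥0) * h with hr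
  have hru : r ≤ u := by
    rw [hr]
    have := Nat.floor_le (bot_le : (0 : ℝ≥0) ≤ u / h)
    rw [← hj] at this
    calc (j : ℝ≥0) * h ≤ u / h * h := by gcongr
      _ = u := div_mul_cancel₀ u hh.ne'
  have hur : u < r + h := by
    rw [hr]
    have := Nat.lt_floor_add_one (u / h)
    rw [← hj] at this
    calc u = u / h * h := (div_mul_cancel₀ u hh.ne').symm
      _ < ((j : ℝ≥0) + 1) * h := by gcongr
      _ = (j : ℝ≥0) * h + h := by ring
  have hrv : r ≤ v := hru.trans huv
  set s₁ := u - r with hs₁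
  set s₂ := v - r with hs₂
  have hu : u = r + s₁ := (add_tsub_cancel_of_le hru).symm
  have hv : v = r + s₂ := (add_tsub_cancel_of_le hrv).symm
  have hs₁le : s₁ ≤ 2 * h := by
    rw [hs₁]
    have : u ≤ r + 2 * h := by
      have := hur.le
      calc u ≤ r + h := this
        _ ≤ r + 2 * h := by gcongr; exact le_mul_of_one_le_left h.coe_nonneg (by norm_num)
    exact tsub_le_iff_left.2 this
  have hs₂le : s₂ ≤ 2 * h := by
    rw [hs₂]
    have : v ≤ r + 2 * h := by
      calc v ≤ u + h := hvu
        _ ≤ r + h + h := by gcongr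
        _ = r + 2 * h := by ring
    exact tsub_le_iff_left.2 this
  have h1 := abs_incr_le_incRunSup (u := r) hs₁le ω
  have h2 := abs_incr_le_incRunSup (u := r) hs₂le ω
  rw [← hu] at h1
  rw [← hv] at h2
  have htri : |Process.brownian v ω - Process.brownian u ω| ≤
      |Process.brownian v ω - Process.brownian r ω| + |Process.brownian u ω - Process.brownian r ω| := by
    rw [show Process.brownian v ω - Process.brownian u ω =
      (Process.brownian v ω - Process.brownian r ω) - (Process.brownian u ω - Process.brownian r ω) by ring]
    exact abs_sub _ _
  linarith

/-- **Oscillation bound for Brownian motion**: for `h > 0`, `x > 0` and a horizon `T`,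
`P[∃ u ≤ T, ∃ v ∈ [u, u + h], x ≤ |B_v - B_u|] ≤ (T/h + 1) · 2 exp(-x²/(16h))` (cover `[0, T]` by
`⌊T/h⌋ + 1` blocks of length `h`; an oscillation `≥ x` at lag `≤ h` starting in block `j` forces
`sup_{w ≤ 2h} |B_{jh+w} - B_{jh}| ≥ x/2`). This is the estimate behind Lawler (1996), §3, third
display. [cite: Lawler1996CutTimes, §3] -/
theorem measure_osc_le_exp (T : ℝ≥0) {h : ℝ≥0} (hh : 0 < h) {x : ℝ} (hx : 0 < x) :
    Process.preWienerMeasure {ω | ∃ u v : ℝ≥0, u ≤ T ∧ u ≤ v ∧ v ≤ u + h ∧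
        x ≤ |Process.brownian v ω - Process.brownian u ω|} ≤
      ENNReal.ofReal (((T : ℝ) / h + 1) * (2 * exp (-x ^ 2 / (16 * h)))) := by
  set N := ⌊T / h⌋₊ with hN
  have hsub : {ω : ℝ≥0 → ℝ | ∃ u v : ℝ≥0, u ≤ T ∧ u ≤ v ∧ v ≤ u + h ∧
      x ≤ |Process.brownian v ω - Process.brownian u ω|} ⊆
      ⋃ j ∈ Finset.range (N + 1), {ω | x / 2 ≤ incRunSup ((j : ℝ≥0) * h) (2 * h) ω} := by
    rintro ω ⟨u, v, huT, huv, hvu, hxω⟩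
    simp only [mem_iUnion, Finset.mem_range, mem_setOf_eq, exists_prop]
    refine ⟨⌊u / h⌋₊, ?_, half_le_incRunSup_of_osc hh huv hvu ω hxω⟩
    have : ⌊u / h⌋₊ ≤ N := by
      rw [hN]
      exact Nat.floor_mono (div_le_div_of_nonneg_right huT h.coe_nonneg)
    omega
  refine (measure_mono hsub).trans ((measure_biUnion_finset_le _ _).trans ?_)
  have hx2 : 0 < x / 2 := by positivity
  calc ∑ j ∈ Finset.range (N + 1), Process.preWienerMeasure {ω | x / 2 ≤ incRunSup ((j : ℝ≥0) * h) (2 * h) ω}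
      ≤ ∑ j ∈ Finset.range (N + 1), ENNReal.ofReal (2 * exp (-(x / 2) ^ 2 / (2 * (2 * h : ℝ≥0)))) :=
        Finset.sum_le_sum fun j _ ↦ measure_le_incRunSup_le_exp _ _ hx2
    _ = ∑ j ∈ Finset.range (N + 1), ENNReal.ofReal (2 * exp (-x ^ 2 / (16 * h))) := by
        refine Finset.sum_congr rfl fun j _ ↦ ?_
        have hA : -(x / 2) ^ 2 / (2 * ((2 * h : ℝ≥0) : ℝ)) = -x ^ 2 / (16 * h) := by
          rw [NNReal.coe_mul, NNReal.coe_ofNat]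
          ring
        rw [hA]
    _ = (N + 1 : ℕ) * ENNReal.ofReal (2 * exp (-x ^ 2 / (16 * h))) := by
        rw [Finset.sum_const, Finset.card_range, nsmul_eq_mul]
    _ ≤ ENNReal.ofReal (((T : ℝ) / h + 1) * (2 * exp (-x ^ 2 / (16 * h)))) := by
        rw [ENNReal.ofReal_mul (p := (T : ℝ) / h + 1) (by positivity)]
        have hle : ((N + 1 : ℕ) : ℝ≥0∞) ≤ ENNReal.ofReal ((T : ℝ) / h + 1) := by
          have hN' : ((N + 1 : ℕ) : ℝ≥0∞) = ENNReal.ofReal ((N : ℝ) + 1) := by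
            rw [show ((N : ℝ) + 1) = ((N + 1 : ℕ) : ℝ) by push_cast; ring, ENNReal.ofReal_natCast]
          rw [hN']
          refine ENNReal.ofReal_le_ofReal ?_
          have : (N : ℝ) ≤ (T : ℝ) / h := by
            have h1 := Nat.floor_le (bot_le : (0 : ℝ≥0) ≤ T / h)
            rw [← hN] at h1
            have h2 : ((N : ℝ≥0) : ℝ) ≤ ((T / h : ℝ≥0) : ℝ) := by exact_mod_cast h1
            simpa using h2
          linarith
        exact mul_le_mul' hle le_rfl

/-! ### Transfer to the Wiener law on `C([0, ∞), ℝ)` -/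

/-- The oscillation constraint set `{(u, v) : u ≤ T, u ≤ v ≤ u + h}` is compact. [folklore] -/
theorem isCompact_oscIndex (T h : ℝ≥0) :
    IsCompact {q : ℝ≥0 × ℝ≥0 | q.1 ≤ T ∧ q.1 ≤ q.2 ∧ q.2 ≤ q.1 + h} := by
  have hsub : {q : ℝ≥0 × ℝ≥0 | q.1 ≤ T ∧ q.1 ≤ q.2 ∧ q.2 ≤ q.1 + h} ⊆ Icc 0 T ×ˢ Icc 0 (T + h) := by
    rintro ⟨u, v⟩ ⟨h1, h2, h3⟩
    exact ⟨⟨bot_le, h1⟩, ⟨bot_le, h3.trans (by gcongr)⟩⟩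
  refine (isCompact_Icc.prod isCompact_Icc).of_isClosed_subset ?_ hsub
  have c1 : Continuous fun q : ℝ≥0 × ℝ≥0 ↦ q.1 := continuous_fst
  have c2 : Continuous fun q : ℝ≥0 × ℝ≥0 ↦ q.2 := continuous_snd
  have c3 : Continuous fun q : ℝ≥0 × ℝ≥0 ↦ q.1 + h := continuous_fst.add continuous_const
  have A := isClosed_le c1 (continuous_const (y := T))
  have B := isClosed_le c1 c2
  have C := isClosed_le c2 c3
  exact A.inter (B.inter C)

/-- **The oscillation event is closed in `C([0, ∞), ℝ)`** (compact-open topology): it is the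
projection along the compact constraint set of a closed set. [folklore] -/
theorem isClosed_oscSet (T h : ℝ≥0) (x : ℝ) :
    IsClosed {p : C(ℝ≥0, ℝ) | ∃ u v : ℝ≥0, u ≤ T ∧ u ≤ v ∧ v ≤ u + h ∧ x ≤ |p v - p u|} := by
  set K := {q : ℝ≥0 × ℝ≥0 | q.1 ≤ T ∧ q.1 ≤ q.2 ∧ q.2 ≤ q.1 + h} with hK
  haveI : CompactSpace K := isCompact_iff_compactSpace.1 (isCompact_oscIndex T h)
  set Z : Set (K × C(ℝ≥0, ℝ)) := {z | x ≤ |z.2 (z.1 : ℝ≥0 × ℝ≥0).2 - z.2 (z.1 : ℝ≥0 × ℝ≥0).1|}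
    with hZ
  have hZc : IsClosed Z := by
    have hc2 : Continuous fun z : K × C(ℝ≥0, ℝ) ↦ z.2 (z.1 : ℝ≥0 × ℝ≥0).2 :=
      continuous_eval.comp (continuous_snd.prodMk (continuous_snd.comp
        (continuous_subtype_val.comp continuous_fst)))
    have hc1 : Continuous fun z : K × C(ℝ≥0, ℝ) ↦ z.2 (z.1 : ℝ≥0 × ℝ≥0).1 :=
      continuous_eval.comp (continuous_snd.prodMk (continuous_fst.comp
        (continuous_subtype_val.comp continuous_fst)))
    exact isClosed_le continuous_const (hc2.sub hc1).abs
  have himage : {p : C(ℝ≥0, ℝ) | ∃ u v : ℝ≥0, u ≤ T ∧ u ≤ v ∧ v ≤ u + h ∧ x ≤ |p v - p u|} =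
      Prod.snd '' Z := by
    ext p
    constructor
    · rintro ⟨u, v, h1, h2, h3, h4⟩
      exact ⟨(⟨(u, v), h1, h2, h3⟩, p), h4, rfl⟩
    · rintro ⟨⟨⟨⟨u, v⟩, h1, h2, h3⟩, q⟩, h4, rfl⟩
      exact ⟨u, v, h1, h2, h3, h4⟩
  rw [himage]
  exact isClosedMap_snd_of_compactSpace Z hZc

section PathLaw

variable [MeasurableSpace C(ℝ≥0, ℝ)] [BorelSpace C(ℝ≥0, ℝ)]

/-- The oscillation event is Borel measurable in `C([0, ∞), ℝ)`. [folklore] -/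
theorem measurableSet_oscSet (T h : ℝ≥0) (x : ℝ) :
    MeasurableSet {p : C(ℝ≥0, ℝ) | ∃ u v : ℝ≥0, u ≤ T ∧ u ≤ v ∧ v ≤ u + h ∧ x ≤ |p v - p u|} :=
  (isClosed_oscSet T h x).measurableSet

/-- **Oscillation bound under the Wiener law**: for `h > 0`, `x > 0`,
`W[∃ u ≤ T, ∃ v ∈ [u, u + h], x ≤ |p v - p u|] ≤ (T/h + 1) · 2 exp(-x²/(16h))`. Lawler (1996),
§3, third display ("similar exponential estimates for the Brownian motion").
[cite: Lawler1996CutTimes, §3] -/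
theorem wienerLawC_osc_le_exp (T : ℝ≥0) {h : ℝ≥0} (hh : 0 < h) {x : ℝ} (hx : 0 < x) :
    wienerLawC {p : C(ℝ≥0, ℝ) | ∃ u v : ℝ≥0, u ≤ T ∧ u ≤ v ∧ v ≤ u + h ∧ x ≤ |p v - p u|} ≤
      ENNReal.ofReal (((T : ℝ) / h + 1) * (2 * exp (-x ^ 2 / (16 * h)))) := by
  rw [wienerLawC_apply (measurableSet_oscSet T h x)]
  exact measure_osc_le_exp T hh hx

end PathLaw

end Literature.Probability.RandomPlanarGeometry
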